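import Summits.ValiantsHypothesis.ValiantsHypothesis.Theses.AlgebraicKWGames
import Literature.Computability.AlgebraicComplexity.FormulaUnfoldingDepth

/-!
# AlgebraicKWGames, support item `FormulaToProtocol` (stmt-ValiantsHypothesis-10301) — PROVED

Route `AlgebraicKWGames` of `ValiantsHypothesis`, support item `FormulaToProtocol` (card P1, first
half): a fan-in-two `ArithCircuit` over `ℂ` of depth `≤ D` computing `f` yields, for every
`D' ≥ 2D`, a uniform zero-test algebraic protocol of depth `D'` solving the Karchmer–Wigderson game
of `f` (Alice holds `a`, Bob holds `b`, promise `f(a) ≠ f(b)`; output an index where `a` and `b`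
differ).

Proof — the planner's walk-down, on the UNFOLDED EXPRESSION of the circuit: by
`FormulaUnfolding(Depth).lean` the circuit unfolds to a weighted binary expression `e`
(`ArithCircuit.toWExpr`) with the same value (`eval_toWExpr`) and depth `≤ D`
(`depth_toWExpr_le`).  The protocol keeps a current node of `e`, starting at the root, with the
invariant "the node's polynomial differs at `a` and `b`": in round `2j` Alice announces `e₁(a)` for
the left child `e₁` of the current node, in round `2j+1` Bob announces `e₁(a) − e₁(b)` (his input and
the previous message), and both descend into `e₁` if that is nonzero, into the right child `e₂`
otherwise (`WExpr.descend` along the odd-indexed zero bits); at a weighted-sum node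
`c₁e₁ + c₂e₂` or a product node `e₁e₂` whose value differs, `e₁(a) = e₁(b)` forces `e₂` to differ;
a leaf is its own child, so the walk parks at the first leaf it meets, which cannot be a constant
(constants never differ) and is reached after `≤ depth e ≤ D ≤ D'/2` descents
(`WExpr.descend_eq_var_or_const`); the output is that leaf's variable (`WExpr.rootVar`).
Honest framing: the route's crux `KWPerLowerBound` is an open problem at least as strong as the
extended Valiant hypothesis; VP ≠ VNP is NOT proved and nothing here is progress on it.
-/

noncomputable section

-- the summit and the problem share the name `ValiantsHypothesis` (D-0017 single-conjunct layout)
set_option linter.dupNamespace false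

namespace Summit.ValiantsHypothesis.ValiantsHypothesis.Theorems.AlgebraicKWGames

open Literature.Computability.AlgebraicComplexity

/-- **The walk-down step.** If the value of the node `E` differs at `a` and `b`, then so does the
value of the child chosen by the zero test `d ↔ e₁(a) = e₁(b)` on its left child `e₁` (go right iff
the left values agree). -/
theorem eval_child_ne {ι : Type} (E : WExpr ℂ ι) (a b : ι → ℂ)
    (hE : MvPolynomial.eval a E.eval ≠ MvPolynomial.eval b E.eval) (d : Bool)
    (hd : d = true ↔ MvPolynomial.eval a E.left.eval = MvPolynomial.eval b E.left.eval) :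
    MvPolynomial.eval a (E.child d).eval ≠ MvPolynomial.eval b (E.child d).eval := by
  cases E with
  | var i => rw [WExpr.child_var]; exact hE
  | const c => rw [WExpr.child_const]; exact hE
  | lin c₁ e₁ c₂ e₂ =>
    rw [WExpr.left_lin] at hd
    cases d with
    | true =>
      rw [WExpr.child_true, WExpr.right_lin]
      have heq : MvPolynomial.eval a e₁.eval = MvPolynomial.eval b e₁.eval := hd.mp rfl
      intro hcon
      apply hE
      simp only [WExpr.eval_lin, map_add, MvPolynomial.smul_eval, heq, hcon]
    | false =>
      rw [WExpr.child_false, WExpr.left_lin]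
      exact fun hcon => Bool.false_ne_true (hd.mpr hcon)
  | mul e₁ e₂ =>
    rw [WExpr.left_mul] at hd
    cases d with
    | true =>
      rw [WExpr.child_true, WExpr.right_mul]
      have heq : MvPolynomial.eval a e₁.eval = MvPolynomial.eval b e₁.eval := hd.mp rfl
      intro hcon
      apply hE
      simp only [WExpr.eval_mul, map_mul, heq, hcon]
    | false =>
      rw [WExpr.child_false, WExpr.left_mul]
      exact fun hcon => Bool.false_ne_true (hd.mpr hcon)

set_option maxHeartbeats 800000 in
/-- **`FormulaToProtocol` (stmt-ValiantsHypothesis-10301):** a fan-in-two circuit of depth `≤ D`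
for `f` gives a zero-test protocol of every depth `D' ≥ 2D` for the KW game of `f` — Alice announces
the left child's value at `a`, Bob the difference with its value at `b`, both descend accordingly
(walk-down on the unfolded expression `ArithCircuit.toWExpr`). -/
theorem formulaToProtocol_proof :
    Summit.ValiantsHypothesis.ValiantsHypothesis.Theses.AlgebraicKWGames.FormulaToProtocol := by
  intro ι _ f D D' hDD' hP
  classical
  obtain ⟨P, hP2, hPc, hPd⟩ := hP
  -- the unfolded expression
  obtain ⟨e, hef, hed⟩ : ∃ e : WExpr ℂ ι, e.eval = f ∧ e.depth ≤ D :=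
    ⟨P.toWExpr, by rw [ArithCircuit.eval_toWExpr]; exact hPc,
      (ArithCircuit.depth_toWExpr_le hP2).trans hPd⟩
  -- the current node after the rounds `< t`, read off the odd-indexed zero bits of the history
  set node : (t : ℕ) → (Fin t → Bool) → WExpr ℂ ι := fun t zt =>
    e.descend ((List.range (t / 2)).map fun i =>
      if h : 2 * i + 1 < t then zt ⟨2 * i + 1, h⟩ else false) with hnode_def
  -- the protocol: Alice speaks in even rounds, Bob in odd rounds
  set owner : (t : ℕ) → (Fin t → Bool) → Bool := fun t _ => decide (t % 2 = 0) with howner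
  set msg : (t : ℕ) → (Fin t → Bool) → MvPolynomial (ι ⊕ Fin t) ℂ := fun t zt =>
    if ht : t % 2 = 0 then MvPolynomial.rename Sum.inl (node t zt).left.eval
    else MvPolynomial.X (Sum.inr ⟨t - 1, by omega⟩) -
      MvPolynomial.rename Sum.inl (node t zt).left.eval with hmsg
  set out : (Fin D' → Bool) → ι := fun zD =>
    ((node D' zD).rootVar).getD (Classical.arbitrary ι) with hout
  refine ⟨owner, msg, out, ?_⟩
  intro a b hab m z hz htr
  -- the walk driven by the global history `z`
  set N : ℕ → WExpr ℂ ι := fun j => e.descend ((List.range j).map fun i => z (2 * i + 1)) with hN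
  have hnode : ∀ t, node t (fun j : Fin t => z j) = N (t / 2) := by
    intro t
    simp only [hnode_def, hN]
    congr 1
    refine List.map_congr_left fun i hi => ?_
    rw [List.mem_range] at hi
    have h2 : 2 * i + 1 < t := by omega
    simp [h2]
  have hNsucc : ∀ j, N (j + 1) = (N j).child (z (2 * j + 1)) := by
    intro j
    simp only [hN]
    rw [List.range_succ, List.map_append, List.map_singleton, WExpr.descend_append_singleton]
  -- the invariant: after `j` descents (rounds `< 2j`) the node's value differs at `a` and `b`
  have hinv : ∀ j, 2 * j ≤ D' →
      MvPolynomial.eval a (N j).eval ≠ MvPolynomial.eval b (N j).eval := by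
    intro j
    induction j with
    | zero =>
      intro _
      simpa [hN, hef] using hab
    | succ j ih =>
      intro hj
      have IH := ih (by omega)
      -- round `2j`: Alice announces the left child's value at `a`
      have h0 := htr (2 * j) (by omega)
      have heven : (2 * j) % 2 = 0 := Nat.mul_mod_right 2 j
      have hdiv0 : 2 * j / 2 = j := by omega
      simp only [howner, hmsg, heven, decide_true, if_true, dif_pos, hnode, hdiv0,
        MvPolynomial.eval_rename, Sum.elim_comp_inl] at h0
      -- round `2j + 1`: Bob announces the difference with the value at `b`
      have h1 := htr (2 * j + 1) (by omega)
      have hodd : ¬ (2 * j + 1) % 2 = 0 := by omega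
      have hdiv1 : (2 * j + 1) / 2 = j := by omega
      simp only [howner, hmsg, hodd, decide_false, if_false, dif_neg, not_false_eq_true, hnode,
        hdiv1, map_sub, MvPolynomial.eval_X, Sum.elim_inr, MvPolynomial.eval_rename,
        Sum.elim_comp_inl, Nat.add_sub_cancel, Bool.false_eq_true] at h1
      -- the zero bit of round `2j + 1` tests `e₁(a) = e₁(b)`
      have hz1 : z (2 * j + 1) = true ↔
          MvPolynomial.eval a (N j).left.eval = MvPolynomial.eval b (N j).left.eval := by
        rw [hz, h1, h0, sub_eq_zero]
      rw [hNsucc j]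
      exact eval_child_ne (N j) a b IH (z (2 * j + 1)) hz1
  -- after `D'/2 ≥ D ≥ depth e` descents the walk sits at a leaf whose value differs: a variable
  have hfin := hinv (D' / 2) (Nat.mul_div_le D' 2)
  have hleaf := WExpr.descend_eq_var_or_const (e := e)
    (l := (List.range (D' / 2)).map fun i => z (2 * i + 1)) (by simp; omega)
  change a (out fun j : Fin D' => z j) ≠ b (out fun j : Fin D' => z j)
  simp only [hout, hnode]
  rcases hleaf with ⟨i, hi⟩ | ⟨c, hc⟩
  · have hNi : N (D' / 2) = WExpr.var i := hi
    rw [hNi] at hfin ⊢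
    simpa using hfin
  · have hNc : N (D' / 2) = WExpr.const c := hc
    rw [hNc] at hfin
    exact absurd (by simp) hfin

end Summit.ValiantsHypothesis.ValiantsHypothesis.Theorems.AlgebraicKWGames
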